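import Summits.Ventures.HodgeRepro.CMType

/-!
# Hodge classes of a CM abelian variety: Pohlmann's criterion in the finite-group model

Blind re-derivation cell `pub-hodge-repro`, seat `typer` (gen 1).  Continues `CMType.lean`
(`G` a finite group, `c` a central involution, `Φ` a CM type); sources as there ([Gordon] = B. B. Gordon,
*A survey of the Hodge conjecture for abelian varieties*, arXiv:alg-geom/9709030, §9.2 pp. 24–25).

* `IsHodgeSet c Φ Δ` — Pohlmann's condition (9.2.1) verbatim, with its equivalent forms;
* `hodgeCount / divisorCount / exceptionalCount` — the numbers of [Gordon] §9.2 / §9.2.2;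
* `ind S : G → ℚ` — indicator vectors, `ind Δ ⬝ᵥ ind S = |Δ ∩ S|` (bridge to `CMRank.lean`).
-/

open Finset
open scoped Pointwise

namespace HodgeRepro

variable {G : Type*} [Group G]

/-! ### Hodge type of a subset and Pohlmann's criterion

For the abelian variety `A` of CM type `(K, Φ)` one has `H¹(A, ℂ) = ⊕_{σ ∈ G} ℂ·e_σ` with `e_σ` of Hodge
type `(1,0)` for `σ ∈ Φ` and `(0,1)` for `σ ∈ c • Φ` ([Gordon] §9.1: "`K` acting on `H^{1,0}(A)` as
`⊕_{φ ∈ S} φ`").  Hence `H^n(A, ℂ) = ⋀^n H¹` has the basis `⟨Δ⟩ = ⋀_{σ ∈ Δ} e_σ`, `Δ ⊆ G`, `|Δ| = n`, and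
`⟨Δ⟩` has Hodge type `(|Δ ∩ Φ|, |Δ ∩ c • Φ|)`.

Pohlmann's criterion as printed in [Gordon] §9.2 (Theorem [B.88] Thm. 1, p. 24):
"When `A` is an abelian variety with CM-type `(K, S)`, then `Hdg^p(A) ⊗ ℂ` has a basis consisting of those
`⟨Δ⟩ ∈ H^{2p}(A, ℂ)` such that `|τΔ ∩ S| = |τΔ ∩ S̄|` (9.2.1) for every `τ ∈ G`.  Thus `dim Hdg^p(A)` is
the number of ordered subsets `Δ ⊂ S` [sic], with `|Δ| = 2p`, that satisfy the condition (9.2.1)."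

[Gordon] §9.2.2 Corollary ([B.138]), p. 25: "`dim Hdg^p(A) − dim Div^p(A)` is the number of subsets
`Δ ⊂ Hom(K, ℂ)` such that (a) `Δ − Δ̄ ≠ ∅`, (b) `|Δ ∩ gS| = p` for all `g ∈ G`."

`IsHodgeSet c Φ Δ` below is (9.2.1) verbatim; `isHodgeSet_iff_forall_inter_eq` / `isHodgeSet_iff_two_mul`
are the form (b); `hodgeCount`, `divisorCount`, `exceptionalCount` are the resulting numbers. -/

section HodgeType

variable [DecidableEq G]

/-- `p`-part of the Hodge type of the basis vector `⟨Δ⟩`: the number of `(1,0)`-embeddings in `Δ`. -/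
def hodgeP (Φ Δ : Finset G) : ℕ := (Δ ∩ Φ).card

/-- `q`-part of the Hodge type of `⟨Δ⟩`: the number of `(0,1)`-embeddings in `Δ`. -/
def hodgeQ (c : G) (Φ Δ : Finset G) : ℕ := (Δ ∩ c • Φ).card

/-- The Hodge type `(p, q)` of `⟨Δ⟩` adds up to the degree `|Δ|`. -/
theorem hodgeP_add_hodgeQ [Fintype G] {c : G} {Φ : Finset G} (hc : IsComplexConj c) (hΦ : IsCMType c Φ)
    (Δ : Finset G) : hodgeP Φ Δ + hodgeQ c Φ Δ = Δ.card := by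
  unfold hodgeP hodgeQ
  rw [hΦ.smul_eq_compl hc, ← sdiff_eq_inter_compl, card_inter_add_card_sdiff]

/-- Pohlmann's condition (9.2.1): `|τΔ ∩ Φ| = |τΔ ∩ Φ̄|` for every `τ ∈ G`. -/
def IsHodgeSet (c : G) (Φ Δ : Finset G) : Prop :=
  ∀ τ : G, (τ • Δ ∩ Φ).card = (τ • Δ ∩ c • Φ).card

/-- Pohlmann's condition is decidable on a finite group. -/
instance (c : G) (Φ Δ : Finset G) [Fintype G] : Decidable (IsHodgeSet c Φ Δ) := by
  unfold IsHodgeSet; infer_instance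

/-- Translating `Δ` by `τ` and intersecting with `Φ` is the same as intersecting `Δ` with `τ⁻¹ • Φ`. -/
theorem card_smul_inter (τ : G) (Δ Φ : Finset G) :
    (τ • Δ ∩ Φ).card = (Δ ∩ τ⁻¹ • Φ).card := by
  conv_lhs => rw [← smul_inv_smul τ Φ, ← smul_finset_inter, card_smul_finset]

/-- Pohlmann's condition in the "pairing" form of [Gordon] §9.2.2 (b): `|Δ ∩ gΦ| = |Δ ∩ g Φ̄|` for all
`g ∈ G`. -/
theorem isHodgeSet_iff_forall_inter_eq (c : G) (Φ Δ : Finset G) :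
    IsHodgeSet c Φ Δ ↔ ∀ g : G, (Δ ∩ g • Φ).card = (Δ ∩ g • c • Φ).card := by
  constructor
  · intro h g
    have := h g⁻¹
    rwa [card_smul_inter, card_smul_inter, inv_inv] at this
  · intro h τ
    rw [card_smul_inter, card_smul_inter]
    exact h τ⁻¹

/-- Pohlmann's condition in "half-degree" form: `2·|Δ ∩ gΦ| = |Δ|` for all `g ∈ G`
([Gordon] §9.2.2 (b): `|Δ ∩ gS| = p` with `|Δ| = 2p`). -/
theorem isHodgeSet_iff_two_mul [Fintype G] {c : G} {Φ : Finset G} (hc : IsComplexConj c)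
    (hΦ : IsCMType c Φ) (Δ : Finset G) :
    IsHodgeSet c Φ Δ ↔ ∀ g : G, 2 * (Δ ∩ g • Φ).card = Δ.card := by
  rw [isHodgeSet_iff_forall_inter_eq]
  refine forall_congr' fun g => ?_
  have h := hodgeP_add_hodgeQ hc (hΦ.smul hc g) Δ
  unfold hodgeP hodgeQ at h
  rw [hc.smul_comm_finset] at h
  omega

/-- Pohlmann's condition in "weight" form: `|Δ ∩ gΦ| = p` for all `g ∈ G`, where `|Δ| = 2p`
([Gordon] §9.2.2 (b) verbatim). -/
theorem isHodgeSet_iff_forall_card_eq [Fintype G] {c : G} {Φ : Finset G} (hc : IsComplexConj c)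
    (hΦ : IsCMType c Φ) (Δ : Finset G) (p : ℕ) (hΔ : Δ.card = 2 * p) :
    IsHodgeSet c Φ Δ ↔ ∀ g : G, (Δ ∩ g • Φ).card = p := by
  rw [isHodgeSet_iff_two_mul hc hΦ, hΔ]
  exact forall_congr' fun g => by omega

/-- A Hodge subset has even cardinality (weight `2p`). -/
theorem IsHodgeSet.even_card [Fintype G] {c : G} {Φ Δ : Finset G} (hc : IsComplexConj c) (hΦ : IsCMType c Φ)
    (h : IsHodgeSet c Φ Δ) : Even Δ.card := by
  rw [isHodgeSet_iff_two_mul hc hΦ] at h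
  exact ⟨(Δ ∩ (1 : G) • Φ).card, by rw [← h 1]; ring⟩

/-- Pohlmann's condition is stable under the Galois action on subsets. -/
theorem IsHodgeSet.smul {c : G} {Φ Δ : Finset G} (h : IsHodgeSet c Φ Δ) (g : G) :
    IsHodgeSet c Φ (g • Δ) := by
  intro τ
  rw [smul_smul]
  exact h (τ * g)

/-- Pohlmann's condition is stable under complex conjugation of the subset. -/
theorem IsHodgeSet.conj {c : G} {Φ Δ : Finset G} (h : IsHodgeSet c Φ Δ) :
    IsHodgeSet c Φ (c • Δ) :=
  h.smul c

/-- Pohlmann's condition for the conjugate CM type `Φ̄` is the same condition. -/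
theorem isHodgeSet_smul_iff {c : G} {Φ : Finset G} (hc : IsComplexConj c) (Δ : Finset G) :
    IsHodgeSet c (c • Φ) Δ ↔ IsHodgeSet c Φ Δ := by
  unfold IsHodgeSet
  simp only [hc.smul_smul_finset]
  exact forall_congr' fun τ => eq_comm

/-- Pohlmann's condition for a Galois translate `gΦ` of the CM type is the same condition. -/
theorem isHodgeSet_smul_type_iff {c : G} {Φ : Finset G} (hc : IsComplexConj c) (g : G) (Δ : Finset G) :
    IsHodgeSet c (g • Φ) Δ ↔ IsHodgeSet c Φ Δ := by
  rw [isHodgeSet_iff_forall_inter_eq, isHodgeSet_iff_forall_inter_eq]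
  have key : ∀ a : G, a • c • g • Φ = (a * g) • c • Φ := fun a => by
    rw [smul_smul, smul_smul, smul_smul, mul_assoc a c g, hc.comm g, ← mul_assoc]
  constructor
  · intro h a
    have := h (a * g⁻¹)
    rwa [key, smul_smul, inv_mul_cancel_right] at this
  · intro h a
    rw [key, smul_smul]
    exact h (a * g)

/-- A conjugation-stable subset (`c • Δ = Δ`) satisfies Pohlmann's condition: these are the classes
generated by divisors ([Gordon] §9.2.2: the exceptional ones are those with `Δ ≠ Δ̄`). -/
theorem isHodgeSet_of_smul_eq {c : G} {Φ Δ : Finset G} (hc : IsComplexConj c) (hΔ : c • Δ = Δ) :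
    IsHodgeSet c Φ Δ := by
  intro τ
  have : τ • Δ ∩ c • Φ = c • (τ • Δ ∩ Φ) := by
    rw [smul_finset_inter, hc.smul_comm_finset, hΔ]
  rw [this, card_smul_finset]

/-- `⟨Δ⟩` is an *exceptional* Hodge class candidate: Pohlmann's condition holds but `Δ` is not
conjugation-stable ([Gordon] §9.2.2 (a)+(b)). -/
def IsExceptional (c : G) (Φ Δ : Finset G) : Prop :=
  IsHodgeSet c Φ Δ ∧ c • Δ ≠ Δ

/-- `IsExceptional` is decidable on a finite group. -/
instance (c : G) (Φ Δ : Finset G) [Fintype G] : Decidable (IsExceptional c Φ Δ) := by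
  unfold IsExceptional; infer_instance

variable [Fintype G]

/-- The complement of a Hodge subset is a Hodge subset (Poincaré duality on the basis `⟨Δ⟩`). -/
theorem IsHodgeSet.compl {c : G} {Φ Δ : Finset G} (hc : IsComplexConj c) (hΦ : IsCMType c Φ)
    (h : IsHodgeSet c Φ Δ) : IsHodgeSet c Φ Δᶜ := by
  rw [isHodgeSet_iff_two_mul hc hΦ] at h ⊢
  intro g
  have hg := (hΦ.smul hc g).two_mul_card hc
  have h1 : (Δᶜ ∩ g • Φ).card + (Δ ∩ g • Φ).card = (g • Φ).card := by
    rw [inter_comm, inter_comm Δ, ← sdiff_eq_inter_compl, card_sdiff_add_card_inter]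
  have h2 := card_compl Δ
  rw [card_smul_finset] at hg h1
  have h3 := h g
  omega

omit [Fintype G] in
/-- The empty subset is a Hodge subset (the class `1 ∈ H⁰`). -/
theorem isHodgeSet_empty (c : G) (Φ : Finset G) : IsHodgeSet c Φ ∅ := by
  intro τ; simp

/-- `G` itself is a Hodge subset (the fundamental class in `H^{2g}`). -/
theorem isHodgeSet_univ {c : G} {Φ : Finset G} (hc : IsComplexConj c) (hΦ : IsCMType c Φ) :
    IsHodgeSet c Φ univ := by
  simpa using (isHodgeSet_empty c Φ).compl hc hΦ

/-- The number of Pohlmann subsets of size `2p`: by Pohlmann's theorem (as printed in [Gordon] §9.2) this is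
`dim_ℚ Hdg^p(A)` for the abelian variety `A` of CM type `(K, Φ)`. -/
def hodgeCount (c : G) (Φ : Finset G) (p : ℕ) : ℕ :=
  (univ.filter fun Δ : Finset G => Δ.card = 2 * p ∧ IsHodgeSet c Φ Δ).card

/-- The number of conjugation-stable subsets of size `2p` (the divisor-generated part, [Gordon] §9.2.2). -/
def divisorCount (c : G) (p : ℕ) : ℕ :=
  (univ.filter fun Δ : Finset G => Δ.card = 2 * p ∧ c • Δ = Δ).card

/-- The number of exceptional subsets of size `2p` ([Gordon] §9.2.2: `dim Hdg^p(A) − dim Div^p(A)`). -/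
def exceptionalCount (c : G) (Φ : Finset G) (p : ℕ) : ℕ :=
  (univ.filter fun Δ : Finset G => Δ.card = 2 * p ∧ IsExceptional c Φ Δ).card

/-- `hodgeCount = divisorCount + exceptionalCount` (the count form of [Gordon] §9.2.2). -/
theorem hodgeCount_eq_add {c : G} {Φ : Finset G} (hc : IsComplexConj c) (p : ℕ) :
    hodgeCount c Φ p = divisorCount c p + exceptionalCount c Φ p := by
  unfold hodgeCount divisorCount exceptionalCount IsExceptional
  rw [← card_union_of_disjoint]
  · congr 1
    ext Δ
    simp only [mem_filter, mem_univ, true_and, mem_union]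
    constructor
    · rintro ⟨h1, h2⟩
      by_cases h : c • Δ = Δ
      · exact Or.inl ⟨h1, h⟩
      · exact Or.inr ⟨h1, h2, h⟩
    · rintro (⟨h1, h2⟩ | ⟨h1, h2, _⟩)
      · exact ⟨h1, isHodgeSet_of_smul_eq hc h2⟩
      · exact ⟨h1, h2⟩
  · rw [disjoint_left]
    intro Δ h1 h2
    simp only [mem_filter, mem_univ, true_and] at h1 h2
    exact h2.2.2 h1.2

/-- The Hodge counts of `Φ` and of its conjugate type agree. -/
theorem hodgeCount_smul {c : G} {Φ : Finset G} (hc : IsComplexConj c) (p : ℕ) :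
    hodgeCount c (c • Φ) p = hodgeCount c Φ p := by
  unfold hodgeCount
  congr 1
  ext Δ
  simp only [mem_filter, mem_univ, true_and, isHodgeSet_smul_iff hc]

/-- The Hodge counts of `Φ` and of a Galois translate `gΦ` agree. -/
theorem hodgeCount_smul_type {c : G} {Φ : Finset G} (hc : IsComplexConj c) (g : G) (p : ℕ) :
    hodgeCount c (g • Φ) p = hodgeCount c Φ p := by
  unfold hodgeCount
  congr 1
  ext Δ
  simp only [mem_filter, mem_univ, true_and, isHodgeSet_smul_type_iff hc]

end HodgeType

/-! ### Indicator vectors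

The weight of the basis vector `⟨Δ⟩` under the cocharacter attached to the conjugate type `gΦ` is
`|Δ ∩ gΦ|`; with indicator vectors in `G → ℚ` this is a dot product.  These vectors are the bridge to
`CMRank.lean` (rank of a CM type = rank of the matrix of indicators of the translates `gΦ`). -/

section Indicator

variable [DecidableEq G]

/-- The indicator vector of a subset `S ⊆ G`, as a rational vector indexed by `G`. -/
def ind (S : Finset G) : G → ℚ := fun h => if h ∈ S then 1 else 0

omit [Group G] in
/-- The indicator vector, pointwise. -/
@[simp] theorem ind_apply (S : Finset G) (h : G) : ind S h = if h ∈ S then 1 else 0 := rfl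

omit [Group G] in
/-- `ind S h ∈ {0, 1}`. -/
theorem ind_apply_eq_zero_or_one (S : Finset G) (h : G) : ind S h = 0 ∨ ind S h = 1 := by
  unfold ind; split_ifs <;> simp

/-- The indicator of a Galois translate is the translated indicator: `ind (g • S) h = ind S (g⁻¹ * h)`. -/
theorem ind_smul (g : G) (S : Finset G) (h : G) : ind (g • S) h = ind S (g⁻¹ * h) := by
  have hmem : h ∈ g • S ↔ g⁻¹ * h ∈ S := by rw [← inv_smul_mem_iff, smul_eq_mul]
  simp only [ind_apply, hmem]

omit [Group G] in
/-- The indicator of the complement. -/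
theorem ind_compl [Fintype G] (S : Finset G) (h : G) : ind Sᶜ h = 1 - ind S h := by
  by_cases hS : h ∈ S <;> simp [ind, hS]

/-- The conjugate of a CM type has indicator `1 - ind Φ`. -/
theorem ind_conj_type [Fintype G] {c : G} {Φ : Finset G} (hc : IsComplexConj c) (hΦ : IsCMType c Φ)
    (h : G) : ind (c • Φ) h = 1 - ind Φ h := by
  rw [hΦ.smul_eq_compl hc, ind_compl]

variable [Fintype G]

omit [Group G] in
/-- The dot product of two indicator vectors counts the intersection. -/
theorem ind_dotProduct_ind (Δ S : Finset G) : ind Δ ⬝ᵥ ind S = ((Δ ∩ S).card : ℚ) := by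
  unfold dotProduct
  have key : ∀ h, ind Δ h * ind S h = if h ∈ Δ ∩ S then (1 : ℚ) else 0 := by
    intro h
    simp only [ind_apply, mem_inter]
    split_ifs <;> simp_all
  simp_rw [key]
  rw [sum_boole, filter_mem_eq_inter, univ_inter]

omit [Group G] in
/-- The sum of the entries of an indicator vector is the cardinality. -/
theorem sum_ind (S : Finset G) : ∑ h, ind S h = (S.card : ℚ) := by
  have := ind_dotProduct_ind univ S
  rw [univ_inter] at this
  rw [← this]
  unfold dotProduct
  refine sum_congr rfl fun h _ => ?_
  simp

/-- Pohlmann's condition in dot-product form: `ind Δ ⬝ᵥ ind (g • Φ) = |Δ| / 2` for all `g`. -/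
theorem isHodgeSet_iff_dotProduct {c : G} {Φ : Finset G} (hc : IsComplexConj c) (hΦ : IsCMType c Φ)
    (Δ : Finset G) :
    IsHodgeSet c Φ Δ ↔ ∀ g : G, 2 * (ind Δ ⬝ᵥ ind (g • Φ)) = (Δ.card : ℚ) := by
  rw [isHodgeSet_iff_two_mul hc hΦ]
  refine forall_congr' fun g => ?_
  rw [ind_dotProduct_ind]
  constructor
  · intro h; exact_mod_cast h
  · intro h; exact_mod_cast h

end Indicator

end HodgeRepro
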